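import Summits.BirchSwinnertonDyer.BirchSwinnertonDyer.Theorems.ThetaPartnerAtTwoSignedMainConjectureCMTwoRankZeroFlatTwistComposite
import Literature.NumberTheory.EllipticCurves.PAdicLFunctionMinusIntegralityProofs
import Literature.NumberTheory.EllipticCurves.PAdicLFunctionMinusDistributionProofs
import HarnessLib

/-!
# Route `ThetaPartnerAtTwo`, crux K2r0P `SignedMainConjectureCMTwoRankZeroOfPub` (stmt-BirchSwinnertonDyer-24945),
# line `rankzero` v14, stub (μ♭)_A: the Hecke sum at a good odd prime for the MINUS symbol, modulo 2 — the symbol algebra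
# behind the transport of FLAT along NEGATIVE (imaginary) quadratic twists

Cell `bsd-wall`, width seat `bsd-wall-tp2-p2-w3` (g2). THEOREMS ONLY (no `def`, no named fact, no `sorry`); pure modular-symbol
algebra for ONE rational newform `g`; minus twin of `…FlatTwistHecke` (p614468) and of `…FlatTwistComposite` §4 (prime case);
helper `--supports` the crux; BSD is not proved by any of this.

For an ODD quadratic character `χ` (twist by `d < 0`) Birch's lemma reads the PLUS symbols of the twisted newform on the MINUS
symbols `[y]⁻_g = ratMinusSymbol g y` of `g` (tree: `CuspFormTwistRatPlusSymbolOdd`). The minus symbol is `1`-periodic, ODD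
(`[−y]⁻ = −[y]⁻`, so EVEN modulo `2`), half-integral at cusps with denominator prime to `N`
(`exists_ratMinusSymbol_eq_div_two_of_coprime`: `I⁻(y) := 2[y]⁻_g ∈ ℤ`; note `[0]⁻ = 0`) and satisfies the same Hecke relations
(`intCast_mul_ratMinusSymbol`). Hence, word for word as on the plus side:
* §1 `sum_ratMinusSymbol_add_div_eq`: `∑_{b mod ℓ} [x + b/ℓ]⁻ = a_ℓ·[ℓx]⁻ − [ℓ²x]⁻`;
* §2 `exists_int_twistedSumMinus_eq`: for `ε ≡ 𝟙_{b≠0} (mod 2)`, `∑_b ε(b)(2[x+b/ℓ]⁻ − 2[b/ℓ]⁻) = I⁻(x) + a_ℓ I⁻(ℓx) + I⁻(ℓ²x) + 2z`;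
* §3 `exists_dilationSetMinus_prime`: the Jacobi-twisted minus sum `∑_u (u/ℓ)(2[y+u/ℓ]⁻ − 2[u/ℓ]⁻)` is `≡ ∑_{t∈S_ℓ} 2[ty]⁻ (mod 2ℤ)`
  with `S_ℓ = {1, ℓ²}` or `{1, ℓ, ℓ²}` by the parity of `a_ℓ`.

References: B. Mazur, J. Tate, J. Teitelbaum, Invent. Math. 84 (1986) §I.4 (4.2), §I.8 [MazurTateTeitelbaum1986Invent];
Ju. I. Manin (1972) Prop. 1.4, Thm. 1.6 [Manin1972]; M. Emerton, R. Pollack, T. Weston, Invent. Math. 163 (2006) Lemma 4.4.4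
[EmertonPollackWeston2006].
-/

set_option autoImplicit false
-- the Theorems namespace of this sub repeats the summit name by design (D-0017 nested layout)
set_option linter.dupNamespace false

noncomputable section

open scoped Classical MatrixGroups ModularForm NumberTheorySymbols

open CongruenceSubgroup Literature.NumberTheory.EllipticCurves Literature.NumberTheory.EllipticCurves.ModularForms

namespace Summit.BirchSwinnertonDyer.BirchSwinnertonDyer.Theorems.FlatTwist

/-! ## §1. The translation sum for the minus symbol -/

section Hecke

variable {N : ℕ} [NeZero N] (g : CuspForm (Gamma0 N) 2)

/-- **`2·[y]⁻_g ∈ ℤ`** at a cusp with denominator prime to the level (real coefficients; Manin). [cite: Manin1972, Prop. 1.4 and Thm. 1.6] -/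
theorem exists_two_mul_ratMinusSymbol_eq_intCast (hreal : ∀ n, (cuspCoeff g n).im = 0) {y : ℚ}
    (hy : y.den.Coprime N) : ∃ m : ℤ, 2 * ratMinusSymbol g y = m := by
  obtain ⟨k, hk⟩ := exists_ratMinusSymbol_eq_div_two_of_coprime g hreal hy
  exact ⟨k, by rw [hk]; ring⟩

/-- **The translation sum for the minus symbol**: `∑_{b mod ℓ} [x + b/ℓ]⁻_g = a·[ℓx]⁻_g − [ℓ²x]⁻_g` (`a = a_ℓ(g)`, `ℓ ∤ N` prime).
[cite: MazurTateTeitelbaum1986Invent, §I.4 (4.2)] -/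
theorem sum_ratMinusSymbol_add_div_eq (hg : IsNewform0 g) (hQ : coeffField g = ⊥) {ℓ : ℕ} [NeZero ℓ]
    (hℓ : ℓ.Prime) (hℓN : ¬ ℓ ∣ N) {a : ℤ} (ha : cuspCoeff g ℓ = a) (x : ℚ) :
    ∑ b : ZMod ℓ, ratMinusSymbol g (x + (b.val : ℚ) / ℓ) =
      a * ratMinusSymbol g (ℓ * x) - ratMinusSymbol g ((ℓ : ℚ) ^ 2 * x) := by
  have hℓ0 : (ℓ : ℚ) ≠ 0 := by exact_mod_cast hℓ.ne_zero
  have h := intCast_mul_ratMinusSymbol ℓ hg hℓ hℓN ha (ratCast_ratMinusSymbol g hg hQ) ((ℓ : ℚ) * x)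
  have e1 : ∑ j : Fin ℓ, ratMinusSymbol g (((ℓ : ℚ) * x + j) / ℓ) =
      ∑ j ∈ Finset.range ℓ, ratMinusSymbol g (x + (j : ℚ) / ℓ) := by
    rw [Fin.sum_univ_eq_sum_range (fun j ↦ ratMinusSymbol g (((ℓ : ℚ) * x + j) / ℓ)) ℓ]
    refine Finset.sum_congr rfl fun j _ ↦ ?_
    congr 1
    field_simp
  have e2 : ∑ b : ZMod ℓ, ratMinusSymbol g (x + (b.val : ℚ) / ℓ) =
      ∑ j ∈ Finset.range ℓ, ratMinusSymbol g (x + (j : ℚ) / ℓ) :=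
    sum_zmod_val_eq_sum_range (fun j ↦ ratMinusSymbol g (x + (j : ℚ) / ℓ))
  have e3 : (ℓ : ℚ) * ((ℓ : ℚ) * x) = (ℓ : ℚ) ^ 2 * x := by ring
  rw [e1, e3] at h
  rw [e2]
  linear_combination -h

/-- At `x = 0`: `∑_{b mod ℓ} [b/ℓ]⁻_g = 0` (`[0]⁻ = 0`). [cite: MazurTateTeitelbaum1986Invent, §I.4 (4.2)] -/
theorem sum_ratMinusSymbol_div_eq (hg : IsNewform0 g) (hQ : coeffField g = ⊥) {ℓ : ℕ} [NeZero ℓ]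
    (hℓ : ℓ.Prime) (hℓN : ¬ ℓ ∣ N) {a : ℤ} (ha : cuspCoeff g ℓ = a) :
    ∑ b : ZMod ℓ, ratMinusSymbol g ((b.val : ℚ) / ℓ) = 0 := by
  have h := sum_ratMinusSymbol_add_div_eq g hg hQ hℓ hℓN ha 0
  simp only [zero_add, mul_zero, ratMinusSymbol_zero, sub_zero] at h
  exact h

end Hecke

/-! ## §2. The `ε`-twisted minus sum modulo `2ℤ` -/

section Twisted

variable {N : ℕ} [NeZero N] (g : CuspForm (Gamma0 N) 2)

/-- **Twisted minus sum ≡ Euler-factor dilates (mod 2)**: for a weight `ε ≡ 𝟙_{b ≠ 0} (mod 2)` and `den x` prime to `N`,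
`∑_{b mod ℓ} ε(b)·(2[x + b/ℓ]⁻ − 2[b/ℓ]⁻) = I⁻(x) + a·I⁻(ℓx) + I⁻(ℓ²x) + 2z`, `I⁻(y) = 2[y]⁻_g ∈ ℤ`.
[cite: MazurTateTeitelbaum1986Invent, §I.4 (4.2) and §I.8] [cite: EmertonPollackWeston2006, Lemma 4.4.4] -/
theorem exists_int_twistedSumMinus_eq (hg : IsNewform0 g) (hQ : coeffField g = ⊥) {ℓ : ℕ} [NeZero ℓ]
    (hℓ : ℓ.Prime) (hℓN : ¬ ℓ ∣ N) {a : ℤ} (ha : cuspCoeff g ℓ = a) (ε : ZMod ℓ → ℤ)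
    (hε : ∀ b, ∃ t : ℤ, ε b = (if b = 0 then 0 else 1) + 2 * t) {x : ℚ} (hx : x.den.Coprime N) :
    ∃ z : ℤ, ∑ b : ZMod ℓ, (ε b : ℚ) *
        (2 * ratMinusSymbol g (x + (b.val : ℚ) / ℓ) - 2 * ratMinusSymbol g ((b.val : ℚ) / ℓ)) =
      2 * ratMinusSymbol g x + a * (2 * ratMinusSymbol g (ℓ * x)) + 2 * ratMinusSymbol g ((ℓ : ℚ) ^ 2 * x) + 2 * z := by
  have hreal : ∀ n, (cuspCoeff g n).im = 0 := cuspCoeff_im_eq_zero_of_coeffField_eq_bot hQ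
  have hℓN' : ℓ.Coprime N := (Nat.Prime.coprime_iff_not_dvd hℓ).mpr hℓN
  choose i hi using fun b : ZMod ℓ ↦
    exists_two_mul_ratMinusSymbol_eq_intCast g hreal (coprime_den_add_natCast_div hx hℓN' b.val)
  choose j hj using fun b : ZMod ℓ ↦
    exists_two_mul_ratMinusSymbol_eq_intCast g hreal (coprime_den_natCast_div hℓN' b.val)
  choose t ht using hε
  obtain ⟨v, hv⟩ := exists_two_mul_ratMinusSymbol_eq_intCast g hreal (coprime_den_natCast_mul hx ℓ)
  obtain ⟨w, hw⟩ := exists_two_mul_ratMinusSymbol_eq_intCast g hreal (coprime_den_natCast_mul hx (ℓ ^ 2))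
  have hi0 : (i 0 : ℚ) = 2 * ratMinusSymbol g x := by
    rw [← hi 0, ZMod.val_zero, Nat.cast_zero, zero_div, add_zero]
  have hj0 : (j 0 : ℚ) = 0 := by
    rw [← hj 0, ZMod.val_zero, Nat.cast_zero, zero_div, ratMinusSymbol_zero, mul_zero]
  have hS1 := sum_ratMinusSymbol_add_div_eq g hg hQ hℓ hℓN ha x
  have hS0 := sum_ratMinusSymbol_div_eq g hg hQ hℓ hℓN ha
  have hsumI : ∑ b : ZMod ℓ, (i b : ℚ) = 2 * (a * ratMinusSymbol g (ℓ * x) - ratMinusSymbol g ((ℓ : ℚ) ^ 2 * x)) := by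
    have h : ∑ b : ZMod ℓ, (i b : ℚ) = ∑ b : ZMod ℓ, 2 * ratMinusSymbol g (x + (b.val : ℚ) / ℓ) :=
      Finset.sum_congr rfl fun b _ ↦ by rw [← hi b]
    rw [h, ← Finset.mul_sum, hS1]
  have hsumJ : ∑ b : ZMod ℓ, (j b : ℚ) = 0 := by
    have h : ∑ b : ZMod ℓ, (j b : ℚ) = ∑ b : ZMod ℓ, 2 * ratMinusSymbol g ((b.val : ℚ) / ℓ) :=
      Finset.sum_congr rfl fun b _ ↦ by rw [← hj b]
    rw [h, ← Finset.mul_sum, hS0, mul_zero]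
  have hpw : ((ℓ ^ 2 : ℕ) : ℚ) * x = (ℓ : ℚ) ^ 2 * x := by push_cast; ring
  rw [hpw] at hw
  have hterm : ∀ b : ZMod ℓ, (ε b : ℚ) *
      (2 * ratMinusSymbol g (x + (b.val : ℚ) / ℓ) - 2 * ratMinusSymbol g ((b.val : ℚ) / ℓ)) =
      ((if b = 0 then (0 : ℚ) else 1) * ((i b : ℚ) - j b)) + 2 * ((t b : ℚ) * ((i b : ℚ) - j b)) := by
    intro b
    rw [hi b, hj b, ht b]
    push_cast
    split_ifs <;> ring
  rw [Finset.sum_congr rfl fun b _ ↦ hterm b, Finset.sum_add_distrib, ← Finset.mul_sum]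
  have hind : ∑ b : ZMod ℓ, (if b = 0 then (0 : ℚ) else 1) * ((i b : ℚ) - j b) =
      ∑ b : ZMod ℓ, ((i b : ℚ) - j b) - ((i 0 : ℚ) - j 0) := by
    have h : ∀ b : ZMod ℓ, (if b = 0 then (0 : ℚ) else 1) * ((i b : ℚ) - j b) =
        ((i b : ℚ) - j b) - (if b = 0 then ((i b : ℚ) - j b) else 0) := by
      intro b; split_ifs <;> ring
    rw [Finset.sum_congr rfl fun b _ ↦ h b, Finset.sum_sub_distrib, Finset.sum_ite_eq']
    simp
  rw [hind, Finset.sum_sub_distrib, hsumI, hsumJ, hi0, hj0]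
  refine ⟨∑ b : ZMod ℓ, t b * (i b - j b) - w - i 0, ?_⟩
  push_cast
  rw [← hw, hi0]
  ring

end Twisted

/-! ## §3. The dilation set of a prime modulus for the minus symbol -/

section Dilation

variable {N : ℕ} [NeZero N] (g : CuspForm (Gamma0 N) 2)

/-- **The minus dilation set of a PRIME modulus**: for `ℓ ∤ N` prime with `a_ℓ(g) = a ∈ ℤ` there is a non-empty `S ⊆ {1, ℓ, ℓ²}` of
divisors of `ℓ²` with `∑_{u mod ℓ} (u/ℓ)(2[y + u/ℓ]⁻ − 2[u/ℓ]⁻) ≡ ∑_{t∈S} 2[ty]⁻ (mod 2ℤ)` for every `y` with `den y` prime to `N`.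
[cite: MazurTateTeitelbaum1986Invent, §I.4 (4.2) and §I.8] -/
theorem exists_dilationSetMinus_prime (hg : IsNewform0 g) (hQ : coeffField g = ⊥) {ℓ : ℕ} [NeZero ℓ] (hp : ℓ.Prime)
    (hℓN : ¬ ℓ ∣ N) {a : ℤ} (ha : cuspCoeff g ℓ = a) :
    ∃ S : Finset ℕ, S.Nonempty ∧ (∀ t ∈ S, t ∣ ℓ ^ 2) ∧
      ∀ y : ℚ, y.den.Coprime N → ∃ z : ℤ,
        ∑ u : ZMod ℓ, (J((u.val : ℤ) | ℓ) : ℚ) *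
            (2 * ratMinusSymbol g (y + (u.val : ℚ) / ℓ) - 2 * ratMinusSymbol g ((u.val : ℚ) / ℓ)) =
          ∑ t ∈ S, 2 * ratMinusSymbol g ((t : ℚ) * y) + 2 * z := by
  have hreal : ∀ n, (cuspCoeff g n).im = 0 := cuspCoeff_im_eq_zero_of_coeffField_eq_bot hQ
  have h1 : (1 : ℕ) ≠ ℓ ^ 2 := fun h ↦ hp.one_lt.ne' (by nlinarith [hp.one_lt])
  have h1' : (1 : ℕ) ≠ ℓ := hp.one_lt.ne
  have hll : ℓ ≠ ℓ ^ 2 := fun h ↦ by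
    have : ℓ * 1 = ℓ * ℓ := by rw [mul_one, ← sq]; exact h
    exact hp.one_lt.ne (Nat.eq_of_mul_eq_mul_left hp.pos this)
  refine ⟨if Even a then ({1, ℓ ^ 2} : Finset ℕ) else {1, ℓ, ℓ ^ 2}, by split_ifs <;> simp, ?_, ?_⟩
  · intro t ht
    split_ifs at ht
    · simp only [Finset.mem_insert, Finset.mem_singleton] at ht
      rcases ht with rfl | rfl
      · exact one_dvd _
      · exact dvd_rfl
    · simp only [Finset.mem_insert, Finset.mem_singleton] at ht
      rcases ht with rfl | rfl | rfl
      · exact one_dvd _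
      · exact dvd_pow_self _ two_ne_zero
      · exact dvd_rfl
  intro y hy
  obtain ⟨z₁, hz₁⟩ := exists_int_twistedSumMinus_eq g hg hQ hp hℓN ha (fun b ↦ J((b.val : ℤ) | ℓ))
    (exists_jacobiSym_val_eq_indicator_add hp) hy
  obtain ⟨v, hv⟩ := exists_two_mul_ratMinusSymbol_eq_intCast g hreal (coprime_den_natCast_mul hy ℓ)
  have hsq : ((ℓ ^ 2 : ℕ) : ℚ) * y = (ℓ : ℚ) ^ 2 * y := by push_cast; ring
  by_cases hae : Even a
  · rw [if_pos hae]
    obtain ⟨r, hr⟩ := hae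
    refine ⟨z₁ + r * v, ?_⟩
    rw [hz₁, Finset.sum_pair h1, Nat.cast_one, one_mul, hsq, hv]
    have hr' : (a : ℚ) = r + r := by exact_mod_cast hr
    push_cast
    linear_combination (v : ℚ) * hr'
  · rw [if_neg hae]
    have hao : Odd a := Int.not_even_iff_odd.mp hae
    obtain ⟨r, hr⟩ := hao
    refine ⟨z₁ + r * v, ?_⟩
    rw [hz₁, Finset.sum_insert (by simp [h1', h1]), Finset.sum_pair hll, Nat.cast_one, one_mul, hsq, hv]
    have hr' : (a : ℚ) = 2 * r + 1 := by exact_mod_cast hr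
    push_cast
    linear_combination (v : ℚ) * hr'

end Dilation

end Summit.BirchSwinnertonDyer.BirchSwinnertonDyer.Theorems.FlatTwist

end
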